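import Summits.NavierStokesRegularity.NavierStokesRegularity.Theorems.StrainClockDoorsDefs
import HarnessLib

/-!
# StrainClockDoorsCompositions — S38 compositions I (§5, first half: trace step, allowance, Riccati, doors A1 from the plates)

P0-38 part 2 of 4: §5 up to `strainClockLiouville_of` (`inner_apply_self_eq_zero_of_nonpos_of_trace_eq_zero`, `inner_fderiv_apply_self_eq_zero_of_nonpos_of_isDivFree`, `tendsto_allowance`, `strainThresholdOn_riccati`, `strainClockNoStretching_of`, `strainClockLiouville_of`) of nsreg-p1 g32's `r36/Sketch38.lean` sha16 a4b540f36e6f6589 (ROUND-36 acb2d0e710b3adcc; PLATE-AID-38 §3),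
every declaration byte-identical, order preserved; landed by ns-s29-p2 g4 on LEAD ns-s30-p1 g3's key 2026-08-28T20:16:56Z (g),
`--supports stmt-NavierStokesRegularity-0056 --as helper`.

HONEST FRAME: door family S38 «StrainClockDoors» = the strain-clock criteria (forward door A0 «StrainRatioDoor»; ANCIENT /
Type-I-ancient rate-free Liouville-type doors A1/A2) about HYPOTHETICAL blow-up profiles; items 0056 `NoTypeII`, 10661 and NS
regularity are NOT proved; nothing here is a route or a summit statement.
-/

noncomputable section

open MeasureTheory Set Function Filter Metric Real InnerProductSpace
open _root_.Topology
open scoped ENNReal NNReal RealInnerProductSpace ContDiff Laplacian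
open Literature.Analysis Literature.Analysis.FluidPDE
open Literature.Analysis.FluidPDE.VorticityDirectionDynamics

set_option linter.dupNamespace false

namespace Summit.NavierStokesRegularity.NavierStokesRegularity.Theorems.StrainDoors

open Summit.NavierStokesRegularity.NavierStokesRegularity.Theorems.ArgmaxDoors

-- nested operator types (second derivatives)
set_option maxSynthPendingDepth 3
/-! ## §5 Compositions -/

/-- TRACE STEP (M; linear algebra on `ℝ³`). A linear map whose quadratic form is non-positive on unit vectors and
whose trace vanishes has identically vanishing quadratic form: extend the unit vector to an orthonormal basis
(`Orthonormal.exists_orthonormalBasis_extension`); the trace is the sum of the non-positive diagonal entries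
(`LinearMap.trace_eq_sum_inner`). [folklore] -/
theorem inner_apply_self_eq_zero_of_nonpos_of_trace_eq_zero
    (A : (EuclideanSpace ℝ (Fin 3)) →L[ℝ] (EuclideanSpace ℝ (Fin 3)))
    (hle : ∀ e : EuclideanSpace ℝ (Fin 3), ‖e‖ = 1 → ⟪A e, e⟫ ≤ 0)
    (htr : LinearMap.trace ℝ (EuclideanSpace ℝ (Fin 3))
      (A : (EuclideanSpace ℝ (Fin 3)) →ₗ[ℝ] (EuclideanSpace ℝ (Fin 3))) = 0) :
    ∀ e : EuclideanSpace ℝ (Fin 3), ⟪A e, e⟫ = 0 := by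
  classical
  have hunit : ∀ e : EuclideanSpace ℝ (Fin 3), ‖e‖ = 1 → ⟪A e, e⟫ = 0 := by
    intro e he
    have horth : Orthonormal ℝ ((↑) : (({e} : Set (EuclideanSpace ℝ (Fin 3)))) → EuclideanSpace ℝ (Fin 3)) := by
      rw [orthonormal_iff_ite]
      rintro ⟨i, hi⟩ ⟨j, hj⟩
      rw [Set.mem_singleton_iff] at hi hj
      subst hi
      subst hj
      rw [if_pos rfl, real_inner_self_eq_norm_sq, he, one_pow]
    obtain ⟨w, b, hsub, hb⟩ := horth.exists_orthonormalBasis_extension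
    have hew : e ∈ w := by
      have h := hsub (Set.mem_singleton e)
      simpa using h
    have hsum : ∑ i, ⟪b i, A (b i)⟫ = 0 := by
      have h := LinearMap.trace_eq_sum_inner (A : (EuclideanSpace ℝ (Fin 3)) →ₗ[ℝ] (EuclideanSpace ℝ (Fin 3))) b
      rw [htr] at h
      simpa using h.symm
    have hnonpos : ∀ i ∈ (Finset.univ : Finset w), ⟪b i, A (b i)⟫ ≤ 0 := by
      intro i _
      rw [real_inner_comm]
      exact hle (b i) (b.orthonormal.1 i)
    have hz := (Finset.sum_eq_zero_iff_of_nonpos hnonpos).1 hsum ⟨e, hew⟩ (Finset.mem_univ _)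
    have hbe : b ⟨e, hew⟩ = e := by rw [hb]
    rw [hbe, real_inner_comm] at hz
    exact hz
  intro e
  by_cases he0 : e = 0
  · rw [he0, map_zero, inner_zero_left]
  · have hne : ‖e‖ ≠ 0 := norm_ne_zero_iff.2 he0
    have h1 : ‖‖e‖⁻¹ • e‖ = 1 := by rw [norm_smul, norm_inv, norm_norm, inv_mul_cancel₀ hne]
    have h := hunit _ h1
    have he' : e = ‖e‖ • (‖e‖⁻¹ • e) := by rw [smul_smul, mul_inv_cancel₀ hne, one_smul]
    rw [he', map_smul, real_inner_smul_left, real_inner_smul_right, h, mul_zero, mul_zero]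

/-- TRACE STEP for fields: for a divergence-free `V` (`div V = tr ∇V = 0`), `⟪∇V(x) e,e⟫ ≤ 0` for all unit `e`
forces `⟪∇V(x) e,e⟫ = 0` for all `e`. [folklore] -/
theorem inner_fderiv_apply_self_eq_zero_of_nonpos_of_isDivFree
    (V : (EuclideanSpace ℝ (Fin 3)) → (EuclideanSpace ℝ (Fin 3))) (hdiv : VectorCalculus.IsDivFree V)
    (hle : ∀ (x e : EuclideanSpace ℝ (Fin 3)), ‖e‖ = 1 → ⟪fderiv ℝ V x e, e⟫ ≤ 0)
    (x e : EuclideanSpace ℝ (Fin 3)) : ⟪fderiv ℝ V x e, e⟫ = 0 :=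
  inner_apply_self_eq_zero_of_nonpos_of_trace_eq_zero (fderiv ℝ V x) (hle x) (hdiv x) e


/-- the allowance `η(ε) = 6νε + √ε·K → 0` as `ε ↓ 0`. [folklore] -/
theorem tendsto_allowance (ν K : ℝ) :
    Tendsto (fun ε : ℝ => 6 * ν * ε + Real.sqrt ε * K) (𝓝[>] 0) (𝓝 0) := by
  have hc : Continuous fun ε : ℝ => 6 * ν * ε + Real.sqrt ε * K :=
    (continuous_const.mul continuous_id).add (Real.continuous_sqrt.mul continuous_const)
  have h := hc.tendsto 0
  simp only [mul_zero, Real.sqrt_zero, zero_mul, add_zero] at h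
  exact tendsto_nhdsWithin_of_tendsto_nhds h

/-- **E2_S∘ in RICCATI form** from the linear form: `φ := −B + h/B`, `φB = −B² + h ≤ B'`; at a charged point with
`q > B > 0`, `h ≥ 0`: `−q² + h + η(ε)q ≤ (φ + η(ε))q` (`φq − (−q² + h) = (q − B)(q + h/B) ≥ 0`; verbatim from
`strainThresholdAlmost_of`). [folklore] -/
theorem strainThresholdOn_riccati (hL : StrainThresholdOn) :
    ∀ (ν s₁ s₂ δ : ℝ) (η : ℝ → ℝ), 0 < ν → s₁ < s₂ → 0 < δ → δ < 1 → Tendsto η (𝓝[>] 0) (𝓝 0) →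
    ∀ (u : ℝ → (EuclideanSpace ℝ (Fin 3)) → (EuclideanSpace ℝ (Fin 3)))
      (p : ℝ → (EuclideanSpace ℝ (Fin 3)) → ℝ),
      IsClassicalNSSolutionOn (Icc s₁ s₂) ν 0 u p →
      (∃ K : ℝ, ∀ s ∈ Icc s₁ s₂, ∀ x : EuclideanSpace ℝ (Fin 3), ‖fderiv ℝ (u s) x‖ ≤ K) →
      ∀ (B B' h : ℝ → ℝ), ContinuousOn B (Icc s₁ s₂) → (∀ s ∈ Icc s₁ s₂, 0 < B s) →
        (∀ s ∈ Icc s₁ s₂, HasDerivWithinAt B (B' s) (Icc s₁ s₂) s) →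
        (∀ s ∈ Icc s₁ s₂, -(B s) ^ 2 + h s ≤ B' s) → (∀ s ∈ Icc s₁ s₂, 0 ≤ h s) →
        (∀ ε : ℝ, 0 < ε → ε ≤ 1 → ∀ s ∈ Ioc s₁ s₂, ∀ (x e : EuclideanSpace ℝ (Fin 3)), ‖e‖ = 1 →
          (∀ (y e' : EuclideanSpace ℝ (Fin 3)), ‖e'‖ = 1 →
            (1 + ε * ‖y‖ ^ 2)⁻¹ * strainQuad u s y e' ≤ (1 + ε * ‖x‖ ^ 2)⁻¹ * strainQuad u s x e) →
          (∀ (y e' : EuclideanSpace ℝ (Fin 3)), ‖e'‖ = 1 → (1 - δ) * strainQuad u s y e' ≤ strainQuad u s x e) →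
          B s < strainQuad u s x e →
          strainRateOn (Icc s₁ s₂) u s x e ≤ -(strainQuad u s x e) ^ 2 + h s + η ε * strainQuad u s x e) →
        (∀ (x e : EuclideanSpace ℝ (Fin 3)), ‖e‖ = 1 → strainQuad u s₁ x e ≤ B s₁) →
        ∀ s ∈ Icc s₁ s₂, ∀ (x e : EuclideanSpace ℝ (Fin 3)), ‖e‖ = 1 → strainQuad u s x e ≤ B s := by
  intro ν s₁ s₂ δ η hν h12 hδ hδ1 hη u p hsol hK B B' h hBc hBpos hBd hsuper hh0 hrate hinit
  refine hL ν s₁ s₂ δ η hν h12 hδ hδ1 hη u p hsol hK B B' (fun t => -B t + h t / B t) hBc hBpos hBd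
    ?_ ?_ hinit
  · intro t ht
    have hB := hBpos t ht
    have h1 : (-B t + h t / B t) * B t = -(B t) ^ 2 + h t := by
      have hB0 : B t ≠ 0 := hB.ne'
      rw [add_mul, div_mul_cancel₀ _ hB0]
      ring
    rw [h1]
    exact hsuper t ht
  · intro ε hε hε1 t ht x e he hpen halm hq
    have hB := hBpos t (Ioc_subset_Icc_self ht)
    have hh := hh0 t (Ioc_subset_Icc_self ht)
    have hq0 : 0 ≤ strainQuad u t x e := (hB.trans hq).le
    refine (hrate ε hε hε1 t ht x e he hpen halm hq).trans ?_
    rw [← sub_nonneg]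
    have h1 : (-B t + h t / B t + η ε) * strainQuad u t x e -
        (-(strainQuad u t x e) ^ 2 + h t + η ε * strainQuad u t x e) =
        (strainQuad u t x e - B t) * (strainQuad u t x e + h t / B t) := by
      have hB0 : B t ≠ 0 := hB.ne'
      have h2 : B t * (h t / B t) = h t := mul_div_cancel₀ _ hB0
      linear_combination h2
    rw [h1]
    exact mul_nonneg (sub_pos.2 hq).le (add_nonneg hq0 (div_nonneg hh hB.le))

/-- **Door A1♮ from the plates**: `StrainFrameOn → StrainThresholdOn → StrainClockNoStretching`. On every backward
slab `[s₁,s₂]`: `B(s) = (L'⁻¹ + κ(s − s₁))⁻¹`, `κ = 1 − c`, `L' = max L 1`, `B' = −κB² = φB` with `φ = −κB`; at a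
charged point `q > B(s) > 0`, E1_S♭ + F_S∘ + the ratio hypothesis + `|u| ≤ U` give
`∂ₜq ≤ −q² + cq² + (6νε + √εU)q ≤ (−κB + η(ε))q`; `q(s₁) ≤ L' = B(s₁)`. Hence `q(s₂) ≤ (L'⁻¹ + κ(s₂ − s₁))⁻¹` for
EVERY `s₁ < s₂`, and `s₁ → −∞` gives `q(s₂) ≤ 0`. [folklore] -/
theorem strainClockNoStretching_of (hFr : StrainFrameOn) (hTh : StrainThresholdOn) :
    StrainClockNoStretching := by
  intro ν U L c δ hν hc hδ hδ1 u p hS hU hL hhyp s₂ hs₂ x e he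
  set κ : ℝ := 1 - c with hκ
  have hκ0 : 0 < κ := by rw [hκ]; linarith
  set L' : ℝ := max L 1 with hL'
  have hL'0 : 0 < L' := lt_of_lt_of_le one_pos (le_max_right _ _)
  have hL'b : ∀ s : ℝ, s < 0 → ∀ y : EuclideanSpace ℝ (Fin 3), ‖fderiv ℝ (u s) y‖ ≤ L' :=
    fun s hs y => (hL s hs y).trans (le_max_left _ _)
  -- ### the one-slab bound
  have hslab : ∀ s₁ : ℝ, s₁ < s₂ → strainQuad u s₂ x e ≤ (L'⁻¹ + κ * (s₂ - s₁))⁻¹ := by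
    intro s₁ h12
    have hsol := hS s₁ s₂ h12 hs₂
    set D : ℝ → ℝ := fun s => L'⁻¹ + κ * (s - s₁) with hD
    have hDpos : ∀ s ∈ Icc s₁ s₂, 0 < D s := fun s hs => by
      have h1 : 0 ≤ κ * (s - s₁) := mul_nonneg hκ0.le (sub_nonneg.2 hs.1)
      have h2 : 0 < L'⁻¹ := inv_pos.2 hL'0
      simp only [hD]
      linarith
    set B : ℝ → ℝ := fun s => (D s)⁻¹ with hB
    set B' : ℝ → ℝ := fun s => -κ / (D s) ^ 2 with hB'
    set φ : ℝ → ℝ := fun s => -κ * B s with hφ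
    have hBc : ContinuousOn B (Icc s₁ s₂) := by
      have hDc : Continuous D :=
        continuous_const.add (continuous_const.mul (continuous_id.sub continuous_const))
      exact hDc.continuousOn.inv₀ fun s hs => (hDpos s hs).ne'
    have hBpos : ∀ s ∈ Icc s₁ s₂, 0 < B s := fun s hs => by
      simp only [hB]
      exact inv_pos.2 (hDpos s hs)
    have hBd : ∀ s ∈ Icc s₁ s₂, HasDerivWithinAt B (B' s) (Icc s₁ s₂) s := by
      intro s hs
      have hDd : HasDerivAt D κ s := by
        have h1 : HasDerivAt (fun r : ℝ => L'⁻¹ + κ * (r - s₁)) (0 + κ * 1) s :=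
          (hasDerivAt_const s L'⁻¹).add (((hasDerivAt_id s).sub_const s₁).const_mul κ)
        rw [zero_add, mul_one] at h1
        exact h1
      have h := hDd.inv (hDpos s hs).ne'
      exact h.hasDerivWithinAt
    have hsuper : ∀ s ∈ Icc s₁ s₂, φ s * B s ≤ B' s := by
      intro s hs
      have hD0 : D s ≠ 0 := (hDpos s hs).ne'
      simp only [hφ, hB, hB']
      rw [div_eq_mul_inv, ← inv_pow]
      apply le_of_eq
      ring
    have hrate : ∀ ε : ℝ, 0 < ε → ε ≤ 1 → ∀ s ∈ Ioc s₁ s₂, ∀ (x e : EuclideanSpace ℝ (Fin 3)), ‖e‖ = 1 →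
        (∀ (y e' : EuclideanSpace ℝ (Fin 3)), ‖e'‖ = 1 →
          (1 + ε * ‖y‖ ^ 2)⁻¹ * strainQuad u s y e' ≤ (1 + ε * ‖x‖ ^ 2)⁻¹ * strainQuad u s x e) →
        (∀ (y e' : EuclideanSpace ℝ (Fin 3)), ‖e'‖ = 1 → (1 - δ) * strainQuad u s y e' ≤ strainQuad u s x e) →
        B s < strainQuad u s x e →
        strainRateOn (Icc s₁ s₂) u s x e ≤ (φ s + (6 * ν * ε + Real.sqrt ε * U)) * strainQuad u s x e := by
      intro ε hε _ s hs x e he hpen halm hbig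
      have hs0 : s < 0 := lt_of_le_of_lt hs.2 hs₂
      have hsI : s ∈ Icc s₁ s₂ := ⟨hs.1.le, hs.2⟩
      have hBs := hBpos s hsI
      have hq0 : 0 < strainQuad u s x e := hBs.trans hbig
      have hsm : ContDiff ℝ ∞ (u s) := hsol.smooth_velocity.contDiff_slice hsI
      have heq := hFr ν s₁ s₂ h12 u p hsol s hsI x e
      have hE := strainGrowthWeighted ν ε hν.le hε (u s) (p s) hsm x e he (fun y => hpen y e he) hq0.le _ heq
      have hfeed := hhyp s hs0 x e ⟨he, halm⟩ hq0
      have hux : ‖u s x‖ ≤ U := hU s hs0 x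
      have h1 : strainRateOn (Icc s₁ s₂) u s x e ≤ -(strainQuad u s x e) ^ 2 + strainFeed u p s x e +
          (6 * ν * ε + Real.sqrt ε * ‖u s x‖) * strainQuad u s x e := by
        unfold strainRateOn strainQuad strainFeed pressureHess
        linarith [hE]
      have hallow : (6 * ν * ε + Real.sqrt ε * ‖u s x‖) * strainQuad u s x e ≤
          (6 * ν * ε + Real.sqrt ε * U) * strainQuad u s x e := by
        apply mul_le_mul_of_nonneg_right _ hq0.le
        have := mul_le_mul_of_nonneg_left hux (Real.sqrt_nonneg ε)
        linarith
      have hκq : -(strainQuad u s x e) ^ 2 + c * strainQuad u s x e ^ 2 ≤ φ s * strainQuad u s x e := by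
        have h2 : φ s = -κ * B s := rfl
        have h3 : κ * (B s * strainQuad u s x e) ≤ κ * (strainQuad u s x e * strainQuad u s x e) :=
          mul_le_mul_of_nonneg_left (mul_le_mul_of_nonneg_right hbig.le hq0.le) hκ0.le
        have h4 : -(strainQuad u s x e) ^ 2 + c * strainQuad u s x e ^ 2 =
            -κ * (strainQuad u s x e * strainQuad u s x e) := by
          rw [hκ]
          ring
        rw [h2, h4]
        linarith [h3]
      linarith [h1, hallow, hfeed, hκq]
    have hinit : ∀ (x e : EuclideanSpace ℝ (Fin 3)), ‖e‖ = 1 → strainQuad u s₁ x e ≤ B s₁ := by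
      intro y e' he'
      have h1 : B s₁ = L' := by simp only [hB, hD, sub_self, mul_zero, add_zero, inv_inv]
      rw [h1]
      exact (strainQuad_le_opNorm u s₁ y he').trans (hL'b s₁ (h12.trans hs₂) y)
    have hKb : ∀ s ∈ Icc s₁ s₂, ∀ y : EuclideanSpace ℝ (Fin 3), ‖fderiv ℝ (u s) y‖ ≤ L' :=
      fun s hs y => hL'b s (lt_of_le_of_lt hs.2 hs₂) y
    have hmain := hTh ν s₁ s₂ δ (fun ε => 6 * ν * ε + Real.sqrt ε * U) hν h12 hδ hδ1 (tendsto_allowance ν U)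
      u p hsol ⟨L', hKb⟩ B B' φ hBc hBpos hBd hsuper hrate hinit s₂ ⟨h12.le, le_rfl⟩ x e he
    exact hmain
  -- ### `s₁ → −∞`
  by_contra hpos
  push Not at hpos
  have hκq : 0 < κ * strainQuad u s₂ x e := mul_pos hκ0 hpos
  have h := hslab (s₂ - 2 / (κ * strainQuad u s₂ x e)) (by have := div_pos two_pos hκq; linarith)
  have h3 : L'⁻¹ + κ * (s₂ - (s₂ - 2 / (κ * strainQuad u s₂ x e))) = L'⁻¹ + 2 / strainQuad u s₂ x e := by
    field_simp
    ring
  rw [h3] at h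
  have h5 : 0 < 2 / strainQuad u s₂ x e := div_pos two_pos hpos
  have h4 : 2 / strainQuad u s₂ x e < L'⁻¹ + 2 / strainQuad u s₂ x e := by
    have := inv_pos.2 hL'0
    linarith
  have h6 : (L'⁻¹ + 2 / strainQuad u s₂ x e)⁻¹ < (2 / strainQuad u s₂ x e)⁻¹ :=
    (inv_lt_inv₀ (h5.trans h4) h5).2 h4
  rw [inv_div] at h6
  have h7 : strainQuad u s₂ x e / 2 < strainQuad u s₂ x e := by linarith
  linarith

/-- **Door A1 from A1♮ and «RigidMotion»**. [folklore] -/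
theorem strainClockLiouville_of (hN : StrainClockNoStretching) (hR : RigidMotion) : StrainClockLiouville := by
  intro ν U L c δ hν hc hδ hδ1 u p hS hU hL hhyp s hs x y
  have hq := hN ν U L c δ hν hc hδ hδ1 u p hS hU hL hhyp s hs
  have hsol := hS (s - 1) s (by linarith) hs
  have hmem : s ∈ Icc (s - 1) s := ⟨by linarith, le_rfl⟩
  have hv : ContDiff ℝ 2 (u s) := (hsol.contDiff_velocity hmem).of_le (by norm_cast)
  exact hR (u s) hv
    (inner_fderiv_apply_self_eq_zero_of_nonpos_of_isDivFree (u s) (hsol.divFree s hmem) fun x e he => hq x e he)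
    ⟨U, hU s hs⟩ x y

end Summit.NavierStokesRegularity.NavierStokesRegularity.Theorems.StrainDoors

end
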